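import Summits.AnomalousDissipation.AnomalousDissipation.Theorems.SawtoothPulseCascadeK2ParallelShear
import Literature.Analysis.FunctionSpaces.TorusSupNormContinuity
import Literature.Analysis.FunctionSpaces.TorusEnstrophyOrthogonality

/-!
# Lipschitz bookkeeping on `𝕋²`: operator norm versus partial derivatives, parallel profile fields, and a
# continuous sup envelope
(route `AnomalousDissipation/SawtoothPulseCascade`; helper for the crux ApproxSol58 =
stmt-AnomalousDissipation-19688, S2 `stub_responseLipEnvelope` of the lead's reshaped line `linear-response-lip`)

Elementary tools for reading the realignment pipeline of the forced linearised response (`…ApproxDuhamel`,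
`…ApproxSlotStep`) in the Lipschitz norm `sup_x ‖Dv(x)‖` (`Torus.fderiv`, operator norm):

* §1 `‖∂ᵢ f(x)‖ ≤ ‖Df(x)‖ ≤ Σᵢ ‖∂ᵢ f(x)‖` for `C¹` functions on `𝕋^d` (tree `Torus.fderiv_apply_eq_sum_partialDeriv`);
  partial derivatives of sums;
* §2 parallel profile fields `x ↦ g(x_k) e_m`: `‖·‖ = |g(x_k)|`, `Σᵢ ‖∂ᵢ ·‖ = |g'(x_k)|`, `‖D·‖ ≤ |g'(x_k)|`;
* §3 for a jointly smooth field `u` on `[a, b] × 𝕋^d` the envelope `Λ(t) = Σᵢ ‖∂ᵢ u(t)‖_∞` is CONTINUOUS on `[a, b]`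
  (tree `Torus.IsSmoothSpaceTimeOn.continuousOn_toReal_eSupNorm`), dominates `‖Du(t)(x)‖`, and is at most
  `card d · M` whenever all `‖∂ᵢ u(t)(x)‖ ≤ M` — the continuous Lipschitz majorant demanded by
  `DriftFreeApprox.approximateSolution_of_envelopes` (p473374).
-/

set_option linter.dupNamespace false

noncomputable section

namespace Summit.AnomalousDissipation.AnomalousDissipation.Theorems.SawtoothPulseCascade.ApproxResponse

open Set MeasureTheory
open scoped ContDiff ENNReal
open Literature.Analysis Literature.Analysis.FunctionSpaces Literature.Analysis.FluidPDE
open Summit.AnomalousDissipation.AnomalousDissipation.Theorems.SawtoothPulseCascade.K2Classical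

/-! ## §1 Operator norm versus partial derivatives -/

section OpNorm

variable {d : Type*} [Fintype d] [DecidableEq d] {F : Type*} [NormedAddCommGroup F] [NormedSpace ℝ F]

/-- `‖Df(x)‖ ≤ Σᵢ ‖∂ᵢ f(x)‖` for `C¹` functions on the torus. -/
theorem norm_fderiv_le_sum_norm_partialDeriv {f : UnitAddTorus d → F} (hf : Torus.IsContDiff 1 f)
    (x : UnitAddTorus d) : ‖Torus.fderiv f x‖ ≤ ∑ i, ‖Torus.partialDeriv i f x‖ := by
  refine ContinuousLinearMap.opNorm_le_bound _ (Finset.sum_nonneg fun i _ => norm_nonneg _) fun w => ?_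
  rw [Torus.fderiv_apply_eq_sum_partialDeriv hf x w, Finset.sum_mul]
  refine (norm_sum_le _ _).trans (Finset.sum_le_sum fun i _ => ?_)
  rw [norm_smul, mul_comm]
  exact mul_le_mul_of_nonneg_left (by simpa using PiLp.norm_apply_le w i) (norm_nonneg _)

/-- `‖∂ᵢ f(x)‖ ≤ ‖Df(x)‖` for `C¹` functions on the torus. -/
theorem norm_partialDeriv_le_norm_fderiv {f : UnitAddTorus d → F} (hf : Torus.IsContDiff 1 f) (i : d)
    (x : UnitAddTorus d) : ‖Torus.partialDeriv i f x‖ ≤ ‖Torus.fderiv f x‖ := by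
  rw [Torus.partialDeriv_eq_fderiv_apply hf i x]
  refine (ContinuousLinearMap.le_opNorm _ _).trans ?_
  rw [PiLp.norm_single, norm_one, mul_one]

/-- Partial derivatives of a sum of two `C¹` functions, pointwise. -/
theorem partialDeriv_add_apply {f g : UnitAddTorus d → F} (hf : Torus.IsContDiff 1 f) (hg : Torus.IsContDiff 1 g)
    (i : d) (x : UnitAddTorus d) :
    Torus.partialDeriv i (fun y => f y + g y) x = Torus.partialDeriv i f x + Torus.partialDeriv i g x := by
  have h := congr_fun (Torus.partialDeriv_add hf hg i) x
  rw [Pi.add_apply] at h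
  exact h

end OpNorm

/-! ## §2 Parallel profile fields on `𝕋²` -/

section Parallel

variable {k m : Fin 2}

/-- The pointwise size of a parallel profile field: `‖g(x_k) e_m‖ = |g(x_k)|`. -/
theorem norm_parallel_eq (g : ℝ → ℝ) (x : UnitAddTorus (Fin 2)) :
    ‖g (Torus.repr x k) • EuclideanSpace.single m (1 : ℝ)‖ = |g (Torus.repr x k)| := by
  rw [norm_smul, PiLp.norm_single, norm_one, mul_one, Real.norm_eq_abs]

/-- The partial derivatives of a parallel profile field sum to `|g'(x_k)|`. -/
theorem sum_norm_partialDeriv_parallel {g : ℝ → ℝ} (hg : Function.Periodic g 1) (hgd : Differentiable ℝ g)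
    (x : UnitAddTorus (Fin 2)) :
    ∑ i, ‖Torus.partialDeriv i (fun y : UnitAddTorus (Fin 2) => g (Torus.repr y k) • EuclideanSpace.single m (1 : ℝ)) x‖ =
      |deriv g (Torus.repr x k)| := by
  rw [Finset.sum_eq_single k]
  · rw [partialDeriv_parallelShear_self (k := k) (m := m) hg hgd x, norm_smul, PiLp.norm_single, norm_one,
      mul_one, Real.norm_eq_abs]
  · intro i _ hik
    rw [partialDeriv_parallelShear_of_ne (k := k) (m := m) hg hik x, norm_zero]
  · intro hk
    exact absurd (Finset.mem_univ k) hk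

/-- A parallel profile field with `|g'| ≤ B` has all partial derivatives bounded by `B`. -/
theorem norm_partialDeriv_parallel_le {g : ℝ → ℝ} (hg : Function.Periodic g 1) (hgd : Differentiable ℝ g)
    {B : ℝ} (hB : ∀ y, |deriv g y| ≤ B) (i : Fin 2) (x : UnitAddTorus (Fin 2)) :
    ‖Torus.partialDeriv i (fun y : UnitAddTorus (Fin 2) => g (Torus.repr y k) • EuclideanSpace.single m (1 : ℝ)) x‖ ≤ B := by
  have hB0 : 0 ≤ B := (abs_nonneg _).trans (hB 0)
  by_cases hik : i = k
  · subst hik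
    rw [partialDeriv_parallelShear_self (k := i) (m := m) hg hgd x, norm_smul, PiLp.norm_single, norm_one,
      mul_one, Real.norm_eq_abs]
    exact hB _
  · rw [partialDeriv_parallelShear_of_ne (k := k) (m := m) hg hik x, norm_zero]
    exact hB0

/-- The Lipschitz size of a parallel profile field: `‖D(g(x_k) e_m)(x)‖ ≤ |g'(x_k)|`. -/
theorem norm_fderiv_parallel_le {g : ℝ → ℝ} (hg : Function.Periodic g 1) (hgs : ContDiff ℝ ∞ g)
    (x : UnitAddTorus (Fin 2)) :
    ‖Torus.fderiv (fun y : UnitAddTorus (Fin 2) => g (Torus.repr y k) • EuclideanSpace.single m (1 : ℝ)) x‖ ≤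
      |deriv g (Torus.repr x k)| := by
  have h1 : Torus.IsContDiff 1 (fun y : UnitAddTorus (Fin 2) => g (Torus.repr y k) • EuclideanSpace.single m (1 : ℝ)) :=
    (isSmooth_parallelShear (k := k) (m := m) hg hgs).isContDiff (by simp)
  rw [← sum_norm_partialDeriv_parallel (k := k) (m := m) hg (hgs.differentiable (by simp)) x]
  exact norm_fderiv_le_sum_norm_partialDeriv h1 x

end Parallel

/-! ## §3 The continuous sup envelope of the partial derivatives -/

section Envelope

variable {d : Type*} [Fintype d] [DecidableEq d] {F : Type*} [NormedAddCommGroup F] [NormedSpace ℝ F]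

omit [NormedSpace ℝ F] in
/-- `(‖f‖_∞).toReal ≤ M` from a pointwise bound `‖f x‖ ≤ M` (`M ≥ 0`). -/
theorem toReal_eSupNorm_le {X : Type*} {f : X → F} {M : ℝ} (hM : 0 ≤ M) (h : ∀ x, ‖f x‖ ≤ M) :
    (eSupNorm f).toReal ≤ M := by
  refine ENNReal.toReal_le_of_le_ofReal hM (iSup_le fun x => ?_)
  rw [← ofReal_norm]
  exact ENNReal.ofReal_le_ofReal (h x)

/-- **The continuous Lipschitz envelope.**  For `u` jointly smooth on `[a, b] × 𝕋^d` (`a < b`) the function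
`Λ(t) = Σᵢ ‖∂ᵢ u(t)‖_∞` is continuous on `[a, b]`, dominates the operator norm `‖Du(t)(x)‖` at every point, and is at
most `card d · M` at any time where all partial derivatives are bounded by `M ≥ 0`. -/
theorem exists_lipEnvelope {a b : ℝ} (hab : a < b) {u : ℝ → UnitAddTorus d → F}
    (hu : Torus.IsSmoothSpaceTimeOn (Icc a b) u) :
    ∃ Λ : ℝ → ℝ, ContinuousOn Λ (Icc a b) ∧
      (∀ t ∈ Icc a b, ∀ x, ‖Torus.fderiv (u t) x‖ ≤ Λ t) ∧
      (∀ t ∈ Icc a b, ∀ x, ∑ i, ‖Torus.partialDeriv i (u t) x‖ ≤ Λ t) ∧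
      (∀ t ∈ Icc a b, ∀ M : ℝ, 0 ≤ M → (∀ i x, ‖Torus.partialDeriv i (u t) x‖ ≤ M) →
        Λ t ≤ (Fintype.card d : ℝ) * M) := by
  refine ⟨fun t => ∑ i, (eSupNorm (Torus.partialDeriv i (u t))).toReal, ?_, ?_, ?_, ?_⟩
  · refine continuousOn_finsetSum _ fun i _ => ?_
    exact (hu.partialDeriv (uniqueDiffOn_Icc hab) i).continuousOn_toReal_eSupNorm
  · intro t ht x
    have h1 : Torus.IsContDiff 1 (u t) := (hu.isSmooth_slice ht).isContDiff (by simp)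
    refine (norm_fderiv_le_sum_norm_partialDeriv h1 x).trans (Finset.sum_le_sum fun i _ => ?_)
    exact Torus.norm_le_toReal_eSupNorm ((hu.isSmooth_slice ht).partialDeriv i).continuous x
  · intro t ht x
    exact Finset.sum_le_sum fun i _ =>
      Torus.norm_le_toReal_eSupNorm ((hu.isSmooth_slice ht).partialDeriv i).continuous x
  · intro t _ M hM h
    calc ∑ i, (eSupNorm (Torus.partialDeriv i (u t))).toReal ≤ ∑ _i : d, M :=
          Finset.sum_le_sum fun i _ => toReal_eSupNorm_le hM (h i)
      _ = (Fintype.card d : ℝ) * M := by simp [Finset.sum_const, nsmul_eq_mul]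

end Envelope

end Summit.AnomalousDissipation.AnomalousDissipation.Theorems.SawtoothPulseCascade.ApproxResponse

end
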